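import Summits.Ventures.LatticeQCDFlow.Exactness.IMHAnyStartBurnIn
import Summits.Ventures.LatticeQCDFlow.Exactness.IMHColdStartAcceptance
import HarnessLib

/-!
# Every start: the printed acceptance rate of flow-MCMC from ANY initial law — within
# `max(ā − A, 1 − ā)·r^b·min(1, w(x₀)/N)` of the equilibrium acceptance, and never below the cold start's

HONEST FRAMING: exact (Metropolis-corrected) sampling algorithms for lattice gauge theory;
figures of merit are autocorrelation/cost numbers at stated couplings and volumes; no
continuum-physics claim.

Venture `LatticeQCDFlow` (cell pub-lqcd), topic `Exactness`; FANOUT row 30 (lean-1, GEN-34).  NEW WORK of the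
cell, general state space.  `K = indepMH q w`, `w` normalised and maximal at `x₀`, `A(x)` the acceptance mass at `x`
(`IMHKernel.imhAcceptMass`; `A(x₀) = 1/w(x₀) = A` exactly and `A(x) ≥ A(x₀)` for every `x` — the mode is the stickiest
state, `IMHAcceptMonotone.imhAcceptMass_mode_le`), `ā = ∫ A dπ` the equilibrium acceptance, `r = 1 − A`,
`S_N = Σ_{t<N} r^t`.  GEN-32 (`Exactness/IMHColdStartAcceptance`) computed the expected acceptance rate of a
COLD-STARTED run exactly (`ā − (ā − A)·S_N/N`).  The acceptance rate is the first number every flow-MCMC study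
prints, and runs are started anywhere; by this generation's any-start burn-in law (`Exactness/IMHAnyStartBurnIn`)
applied to the observable `A(·) ∈ [A, 1]`, minimal at the mode:

* **`imh_chain_acceptRate_anyStart_abs_le`** — FROM EVERY INITIAL LAW `μ₀`, every `b` and `N ≥ 1`: the expected
  acceptance rate over the window `[b, b+N)` satisfies
  `|E_{μ₀}[(1/N)Σ_{i<N} A(X_{b+i})] − ā| ≤ max(ā − A, 1 − ā)·r^b·min(1, w(x₀)/N)`;
* **`imh_chain_acceptRate_anyStart_abs_le_of_log_le`** — `log(1/ε) ≤ b/w(x₀)` discarded updates leave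
  `≤ ε·max(ā − A, 1 − ā)`;
* **`imh_chain_acceptRate_anyStart_ge_cold`** — NO START PRINTS A LOWER ACCEPTANCE THAN THE COLD START:
  `E_{x₀}[rate over [b, b+N)] ≤ E_{μ₀}[rate over [b, b+N)]` for every initial law — GEN-32's exact cold-start
  deficit `(ā − A)·r^b·S_N/N` is the largest possible under-estimate of the equilibrium acceptance;
* **`imh_chain_acceptRate_anyStart_ge`** — hence `E_{μ₀}[rate over [b, b+N)] ≥ ā − (ā − A)·r^b·S_N/N` from every
  start (with GEN-32's exact cold law on path space, `IMHAnyStartBurnIn.imh_chain_windowAverage_bias_mode_eq`).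

Reading (gauge files `Scaling/AutoregressiveGauge…AnyStartAcceptance`): whatever configuration law an exact gauge
sampler is started from, its printed acceptance over any window is within `max(ā − A, 1 − ā)(1 − A)^b·min(1, 1/(N·A))`
of the equilibrium acceptance and never below the cold start's `ā − (ā − A)(1 − A)^b S_N/N`.
NOT CLAIMED: the value of `ā` for any weight (GEN-31: `A ≤ ā ≤ ∫ A dq`, `∫ A dq ≥ 1/2`); over-estimates larger than
the cold start's under-estimate are possible from starts concentrated on freely-moving configurations (bounded by
`(1 − ā)·r^b·S_N/N`).

No `sorry`, no new definitions, nothing cited as a fact; general measurable space with measurable singletons.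
-/

noncomputable section

namespace Summit.Ventures.LatticeQCDFlow.Exactness

open MeasureTheory ProbabilityTheory Function Finset
open scoped ENNReal
open Summit.Ventures.LatticeQCDFlow.Scoring

variable {Ω : Type*} [MeasurableSpace Ω] [MeasurableSingletonClass Ω] {q : Measure Ω} [IsProbabilityMeasure q]
  {w : Ω → ℝ}

omit [MeasurableSingletonClass Ω] in
/-- The acceptance profile takes values in `[1/w(x₀), 1]`. [ours, bookkeeping] -/
theorem acceptMass_toReal_mem_Icc (hw0 : ∀ y, 0 < w y) {x₀ : Ω} (hmax : ∀ y, w y ≤ w x₀)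
    [IsProbabilityMeasure (q.withDensity fun y => ENNReal.ofReal (w y))] (x : Ω) :
    (w x₀)⁻¹ ≤ (imhAcceptMass q w x).toReal ∧ (imhAcceptMass q w x).toReal ≤ 1 := by
  constructor
  · rw [← acceptMass_toReal_mode (q := q) hw0 hmax]
    exact ENNReal.toReal_mono (ne_top_of_le_ne_top ENNReal.one_ne_top (imhAcceptMass_le_one q w x))
      (imhAcceptMass_mode_le hw0 hmax x)
  · exact ENNReal.toReal_le_of_le_ofReal zero_le_one
      ((imhAcceptMass_le_one q w x).trans_eq ENNReal.ofReal_one.symm)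

omit [MeasurableSingletonClass Ω] in
/-- **THE PRINTED ACCEPTANCE RATE FROM EVERY START**: for every initial law `μ₀`, every `b` and `N ≥ 1`,
`|E_{μ₀}[(1/N)Σ_{i<N} A(X_{b+i})] − ā| ≤ max(ā − 1/w(x₀), 1 − ā)·r^b·min(1, w(x₀)/N)`. [ours] -/
theorem imh_chain_acceptRate_anyStart_abs_le [Fact (Measurable w)] (hw0 : ∀ y, 0 < w y) {x₀ : Ω}
    (hmax : ∀ y, w y ≤ w x₀) [IsProbabilityMeasure (q.withDensity fun y => ENNReal.ofReal (w y))]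
    (μ₀ : Measure Ω) [IsProbabilityMeasure μ₀] (b : ℕ) {N : ℕ} (hN : N ≠ 0) :
    |∫ x, (∑ i ∈ range N, (imhAcceptMass q w (x (b + i))).toReal) / N
        ∂(Kernel.trajMeasure (X := fun _ : ℕ => Ω) μ₀
          (fun n : ℕ => (indepMH q w).comap (fun h : (i : ↥(Finset.Iic n)) → Ω => h ⟨n, Finset.mem_Iic.2 le_rfl⟩)
            (measurable_pi_apply _))) -
      ∫ x, (imhAcceptMass q w x).toReal ∂(q.withDensity fun y => ENNReal.ofReal (w y))| ≤
      max (∫ x, (imhAcceptMass q w x).toReal ∂(q.withDensity fun y => ENNReal.ofReal (w y)) - (w x₀)⁻¹)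
          (1 - ∫ x, (imhAcceptMass q w x).toReal ∂(q.withDensity fun y => ENNReal.ofReal (w y))) *
        ((1 - (w x₀)⁻¹) ^ b * min 1 (w x₀ / N)) :=
  imh_chain_windowAverage_bias_anyStart_abs_le (q := q) hw0 hmax μ₀ (acceptMass_toReal_facts (q := q) Fact.out).1
    (fun x => (acceptMass_toReal_mem_Icc (q := q) hw0 hmax x).1)
    (fun x => (acceptMass_toReal_mem_Icc (q := q) hw0 hmax x).2) b hN

omit [MeasurableSingletonClass Ω] in
/-- **THE BURN-IN RULE FOR THE ACCEPTANCE RATE, FROM EVERY START**: `log(1/ε) ≤ b/w(x₀)` discarded updates leave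
`|E_{μ₀}[rate over [b, b+N)] − ā| ≤ ε·max(ā − 1/w(x₀), 1 − ā)`. [ours] -/
theorem imh_chain_acceptRate_anyStart_abs_le_of_log_le [Fact (Measurable w)] (hw0 : ∀ y, 0 < w y) {x₀ : Ω}
    (hmax : ∀ y, w y ≤ w x₀) [IsProbabilityMeasure (q.withDensity fun y => ENNReal.ofReal (w y))]
    (μ₀ : Measure Ω) [IsProbabilityMeasure μ₀] {b N : ℕ} (hN : N ≠ 0) {ε : ℝ} (hε : 0 < ε)
    (hb : Real.log (1 / ε) ≤ b * (w x₀)⁻¹) :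
    |∫ x, (∑ i ∈ range N, (imhAcceptMass q w (x (b + i))).toReal) / N
        ∂(Kernel.trajMeasure (X := fun _ : ℕ => Ω) μ₀
          (fun n : ℕ => (indepMH q w).comap (fun h : (i : ↥(Finset.Iic n)) → Ω => h ⟨n, Finset.mem_Iic.2 le_rfl⟩)
            (measurable_pi_apply _))) -
      ∫ x, (imhAcceptMass q w x).toReal ∂(q.withDensity fun y => ENNReal.ofReal (w y))| ≤
      ε * max (∫ x, (imhAcceptMass q w x).toReal ∂(q.withDensity fun y => ENNReal.ofReal (w y)) - (w x₀)⁻¹)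
          (1 - ∫ x, (imhAcceptMass q w x).toReal ∂(q.withDensity fun y => ENNReal.ofReal (w y))) :=
  imh_chain_windowAverage_bias_anyStart_abs_le_of_log_le (q := q) hw0 hmax μ₀
    (acceptMass_toReal_facts (q := q) Fact.out).1 (fun x => (acceptMass_toReal_mem_Icc (q := q) hw0 hmax x).1)
    (fun x => (acceptMass_toReal_mem_Icc (q := q) hw0 hmax x).2) hN hε hb

/-- **NO START PRINTS A LOWER ACCEPTANCE THAN THE COLD START**: for every initial law `μ₀`, every `b` and `N ≥ 1`,
`E_{x₀}[(1/N)Σ_{i<N} A(X_{b+i})] − ā ≤ E_{μ₀}[(1/N)Σ_{i<N} A(X_{b+i})] − ā` (the acceptance profile is minimal at the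
mode). [ours] -/
theorem imh_chain_acceptRate_anyStart_ge_cold [Fact (Measurable w)] (hw0 : ∀ y, 0 < w y) {x₀ : Ω}
    (hmax : ∀ y, w y ≤ w x₀) [IsProbabilityMeasure (q.withDensity fun y => ENNReal.ofReal (w y))]
    (μ₀ : Measure Ω) [IsProbabilityMeasure μ₀] (b : ℕ) {N : ℕ} (hN : N ≠ 0) :
    ∫ x, (∑ i ∈ range N, (imhAcceptMass q w (x (b + i))).toReal) / N
        ∂(Kernel.trajMeasure (X := fun _ : ℕ => Ω) (Measure.dirac x₀)
          (fun n : ℕ => (indepMH q w).comap (fun h : (i : ↥(Finset.Iic n)) → Ω => h ⟨n, Finset.mem_Iic.2 le_rfl⟩)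
            (measurable_pi_apply _))) -
      ∫ x, (imhAcceptMass q w x).toReal ∂(q.withDensity fun y => ENNReal.ofReal (w y)) ≤
    ∫ x, (∑ i ∈ range N, (imhAcceptMass q w (x (b + i))).toReal) / N
        ∂(Kernel.trajMeasure (X := fun _ : ℕ => Ω) μ₀
          (fun n : ℕ => (indepMH q w).comap (fun h : (i : ↥(Finset.Iic n)) → Ω => h ⟨n, Finset.mem_Iic.2 le_rfl⟩)
            (measurable_pi_apply _))) -
      ∫ x, (imhAcceptMass q w x).toReal ∂(q.withDensity fun y => ENNReal.ofReal (w y)) := by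
  have hmin : ∀ x, (imhAcceptMass q w x₀).toReal ≤ (imhAcceptMass q w x).toReal := fun x => by
    rw [acceptMass_toReal_mode (q := q) hw0 hmax]
    exact (acceptMass_toReal_mem_Icc (q := q) hw0 hmax x).1
  exact imh_chain_windowAverage_bias_anyStart_ge_cold (q := q) hw0 hmax μ₀ (acceptMass_toReal_facts (q := q) Fact.out).1
    hmin (fun x => (acceptMass_toReal_mem_Icc (q := q) hw0 hmax x).2) b hN

/-- **… explicitly: `E_{μ₀}[rate over [b, b+N)] ≥ ā − (ā − 1/w(x₀))·r^b·S_N/N` from every start** (GEN-32's exact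
cold-start law is the floor). [ours] -/
theorem imh_chain_acceptRate_anyStart_ge [Fact (Measurable w)] (hw0 : ∀ y, 0 < w y) {x₀ : Ω}
    (hmax : ∀ y, w y ≤ w x₀) [IsProbabilityMeasure (q.withDensity fun y => ENNReal.ofReal (w y))]
    (μ₀ : Measure Ω) [IsProbabilityMeasure μ₀] (b : ℕ) {N : ℕ} (hN : N ≠ 0) :
    ∫ x, (imhAcceptMass q w x).toReal ∂(q.withDensity fun y => ENNReal.ofReal (w y)) -
        (∫ x, (imhAcceptMass q w x).toReal ∂(q.withDensity fun y => ENNReal.ofReal (w y)) - (w x₀)⁻¹) *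
          ((1 - (w x₀)⁻¹) ^ b * ∑ t ∈ range N, (1 - (w x₀)⁻¹) ^ t) / N ≤
      ∫ x, (∑ i ∈ range N, (imhAcceptMass q w (x (b + i))).toReal) / N
        ∂(Kernel.trajMeasure (X := fun _ : ℕ => Ω) μ₀
          (fun n : ℕ => (indepMH q w).comap (fun h : (i : ↥(Finset.Iic n)) → Ω => h ⟨n, Finset.mem_Iic.2 le_rfl⟩)
            (measurable_pi_apply _))) := by
  have h := imh_chain_acceptRate_anyStart_ge_cold (q := q) hw0 hmax μ₀ b hN (x₀ := x₀)
  rw [imh_chain_windowAverage_bias_mode_eq (q := q) hw0 hmax (acceptMass_toReal_facts (q := q) Fact.out).1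
    (acceptMass_toReal_facts (q := q) Fact.out).2 b hN, acceptMass_toReal_mode (q := q) hw0 hmax] at h
  have hneg : ((w x₀)⁻¹ - ∫ x, (imhAcceptMass q w x).toReal ∂(q.withDensity fun y => ENNReal.ofReal (w y))) *
        ((1 - (w x₀)⁻¹) ^ b * ∑ t ∈ range N, (1 - (w x₀)⁻¹) ^ t) / N =
      -((∫ x, (imhAcceptMass q w x).toReal ∂(q.withDensity fun y => ENNReal.ofReal (w y)) - (w x₀)⁻¹) *
        ((1 - (w x₀)⁻¹) ^ b * ∑ t ∈ range N, (1 - (w x₀)⁻¹) ^ t) / N) := by ring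
  rw [hneg] at h
  linarith

end Summit.Ventures.LatticeQCDFlow.Exactness

end
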